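import Summits.NavierStokesRegularity.FluidComputer.ClayBlowupAxisZoomLimit
import Summits.NavierStokesRegularity.FluidComputer.ClayBlowupLocalAxisDecay
import Summits.NavierStokesRegularity.FluidComputer.ClayBlowupLocalAlignment
import Summits.NavierStokesRegularity.FluidComputer.ClayBlowupForcedAxisymTypeI
import HarnessLib

/-!
# NO LOCAL TYPE-I BOUND AT ANY SINGULAR POINT OF AN AXISYMMETRIC CLAY BLOW-UP — WITH ITS CLAY FORCE,
# UNCONDITIONALLY (the Seregin–Šverák half of the K8 row: KNSS 2009 Thm 6.2 localised, with force)

Cell `ns-blowup`, seat `ns-blowup-ecbridge-2` (g12; the E–C endpoint theory seat). LABEL: E–C typing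
(KERNEL — no named fact, no new definition, NO conjecture hypothesis). WHAT THIS IS NOT: not
Navier–Stokes evidence — necessary conditions on the TYPE `ClayBlowup ν`; no inhabitant is claimed.
Companion memo: `run/shared/lean/pub/ns-blowup/ecbridge2/ECBRIDGE-2-MEMO-11.md`.

## Content

g10's `not_typeI_of_isAxisymmetric_forced_of_liouville` excluded a Type-I rate for axisymmetric Clay
blow-ups WITH force only modulo KNSS's open axisymmetric Liouville problem (AX-L), because the
bounded-offset branch of the zoom at GLOBAL near-maxima produces an axisymmetric bounded ancient mild
solution with bounded swirl, for which no Liouville theorem is in print. KNSS's own proof of Thm 6.2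
avoids that object: FIRST `|x'|‖u‖` is shown bounded (blow-up at the running maxima of `|x'|‖u‖`:
the axis RECEDES, the limit is invariant along `e₁`, hence slice-constant by the 2½-D Liouville theorem,
hence zero by the Type-I decay — against the vertex), THEN Thm 6.1 (`|u| ≤ C/|x'|` ⇒ regular). Both steps
are now in the tree WITH THE CLAY FORCE and LOCALISED at a singular point: the first is
`exists_cylRadius_mul_norm_le_of_localTypeI_one` below (assembled from `ClayBlowupAxisZoomLimit`:
engine + vertex; here: sliding lemma `eq_of_tendstoLocallyUniformly_of_rot_about`,
`apply_eq_apply_zero_of_lineInvariant`, `false_of_sliceConst_of_typeI_decay`), the second is g11's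
local KNSS 6.1 with force `not_local_cylRadius_mul_norm_le_one`.

* `ClayBlowup.exists_cylRadius_mul_norm_le_of_localTypeI_one` — (`ν = 1`, axisymmetric slices, axis
  point `x₁`) a local Type-I bound on `(t₀, T) × B(x₁, r₀)` forces `|x'|‖u‖ ≤ C'` on
  `((t₀+T)/2, T) × B(x₁, r₀/4)`;
* `ClayBlowup.not_localTypeI_of_isAxisymmetric_one`, **`ClayBlowup.not_localTypeI_of_isAxisymmetric_forced`**
  (every `ν > 0`, axisymmetric datum and Clay force): at a point `x₁` which is not backward bounded, NO
  bound `‖u(t, x)‖ ≤ C/√(T − t)` for `t` near `T`, `x ∈ B(x₁, r₀)`; `exists_gt_typeI_near_of_isAxisymmetric`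
  (Type II growth inside every ball around every singular point);
* **`ClayBlowup.not_typeI_of_isAxisymmetric_clayForce`** — `¬ IsTypeIBlowup X.u X.T`, UNCONDITIONALLY
  (discharges the (AX-L) hypothesis of g10's theorem); `k8_row_clayForce` — the K8 row with force:
  neither the Type-I rate nor `r‖u‖ ≤ C`; `DesignedBlowup` twins; `(C)`-reading
  `navierStokesBreakdownR3_axisymmetric_typeII`.

References: Koch–Nadirashvili–Seregin–Šverák, Acta Math. 203 (2009), Thms 6.1–6.2
[cite: KochNadirashviliSereginSverak2009, Thm 6.2 and its proof (arXiv pp. 12–13)]; Seregin–Šverák,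
Comm. PDE 34 (2009), Thm 1.1 [cite: SereginSverak2009, Thm 1.1]; C. L. Fefferman, (C)
[cite: FeffermanClay2006, (C)].
-/

noncomputable section

namespace Summit.NavierStokesRegularity.FluidComputer

open Set MeasureTheory Filter Topology Function Metric
open scoped ENNReal NNReal
open Literature.Analysis Literature.Analysis.FluidPDE
open Summit.NavierStokesRegularity.NavierStokesRegularity

namespace ClayBlowup

/-! ## §1 KNSS Thm 6.2, main step, LOCAL and WITH THE CLAY FORCE (`ν = 1`) -/

/-- **TYPE I IN TIME FORCES `|x'|‖u‖` TO BE LOCALLY BOUNDED** (`ν = 1`; axisymmetric slices; `x₁` on the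
axis; no named fact): if `‖u(t, x)‖ ≤ C/√(T − t)` on `(t₀, T) × B(x₁, r₀)` (`r₀ ≤ 2`, `C > 0`), then
`|x'| ‖u(t, x)‖ ≤ C'` on `((t₀ + T)/2, T) × B(x₁, r₀/4)`. Otherwise the axis zoom
(`exists_axis_zoom_limit`) has a limit `W` invariant along `e₁` (the axes recede: sliding lemma), hence
constant on slices (2½-D Liouville), hence zero by the Type-I decay — against `‖W(s, 0)‖ ≥ 1/2`.
[cite: KochNadirashviliSereginSverak2009, proof of Thm 6.2 (arXiv pp. 12–13)] -/
theorem exists_cylRadius_mul_norm_le_of_localTypeI_one (X : ClayBlowup 1)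
    (hax : ∀ t ∈ Ico 0 X.T, IsAxisymmetric (X.u t)) {x₁ : EuclideanSpace ℝ (Fin 3)}
    (hx₁ : cylRadius x₁ = 0) {r₀ t₀ C : ℝ} (hr₀ : 0 < r₀) (hr₀2 : r₀ ≤ 2) (ht₀ : t₀ ∈ Ico 0 X.T)
    (hC : 0 < C) (hI : ∀ t ∈ Ioo t₀ X.T, ∀ x ∈ ball x₁ r₀, ‖X.u t x‖ ≤ C / Real.sqrt (X.T - t)) :
    ∃ C' : ℝ, ∀ t ∈ Ioo ((t₀ + X.T) / 2) X.T, ∀ x ∈ ball x₁ (r₀ / 4),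
      cylRadius x * ‖X.u t x‖ ≤ C' := by
  have hT := X.T_pos
  by_contra hcon
  push Not at hcon
  have hunb : ∀ L : ℝ, ∃ s ∈ Ico ((t₀ + X.T) / 2) X.T, ∃ z ∈ ball x₁ (r₀ / 4),
      L < cylRadius z * ‖X.u s z‖ := fun L => by
    obtain ⟨t, ht, x, hx, hlt⟩ := hcon L
    exact ⟨t, ⟨ht.1.le, ht.2⟩, x, hx, hlt⟩
  obtain ⟨τ, y, φ, W, hφ, hτ, hhalf, hk1, hMlim, hWc, hWdiv, hWmild, hW8, hIW, ⟨σ₁, hσ₁, hvert⟩,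
    hconv⟩ := X.exists_axis_zoom_limit hax hx₁ hr₀ hr₀2 ht₀ hC hI hunb
  obtain ⟨c, hc⟩ : ∃ c : ℕ → ℝ, ∀ k, c k = ‖X.u (τ k) (y k)‖⁻¹ := ⟨_, fun k => rfl⟩
  simp_rw [← hc] at hconv
  have hM0 : ∀ k, 0 < ‖X.u (τ k) (y k)‖ := fun k => lt_of_lt_of_le (by positivity) (hk1 k)
  have hc0 : ∀ k, 0 < c k := fun k => by rw [hc k]; exact inv_pos.2 (hM0 k)
  have htI : ∀ k, τ k ∈ Ioo 0 X.T := fun k =>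
    ⟨lt_of_lt_of_le (by linarith [ht₀.1]) (hτ k).1, (hτ k).2⟩
  have hmem : ∀ s ≤ 0, ∀ᶠ j in atTop, τ (φ j) + c (φ j) ^ 2 * s ∈ Ioc 0 (τ (φ j)) :=
    fun s hs => X.zoom_time_mem_eventually htI hc hk1 hφ hs
  -- ### the limit is smooth, nontrivial, a bounded ancient mild solution
  obtain ⟨hsm, -⟩ := smooth_and_bounds_of_bounded_ancient_oseenMild hWc hWdiv hWmild hW8
  have hslice : ∀ s < 0, ContDiff ℝ (⊤ : ℕ∞) (W s) := fun s hs =>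
    hsm.comp_contDiff (contDiff_prodMk_right s) fun z => mk_mem_prod (mem_Iio.2 hs) (mem_univ z)
  have hWsc : ∀ s < 0, Continuous (W s) := fun s hs => (hslice s hs).continuous
  have hnt : ∃ s < 0, ∃ z, W s z ≠ 0 := by
    refine ⟨-(σ₁ / 2), by linarith, 0, fun h => ?_⟩
    have h1 := hvert (-(σ₁ / 2)) ⟨by linarith, by linarith⟩
    rw [h, norm_zero] at h1
    linarith
  have hbam : IsBoundedAncientMildSolution 1 W :=
    isBoundedAncientMildSolution_of_oseen one_pos hWc ⟨8, hW8⟩ hWdiv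
      (fun s t hst ht z => by rw [one_mul]; exact hWmild s t hst ht z)
  -- ### the zoom slices are axisymmetric about receding axes; the limit is invariant along `e₁`
  have hsym : ∀ k s, τ k + c k ^ 2 * s ∈ Ico 0 X.T → ∀ (θ : ℝ) (z : EuclideanSpace ℝ (Fin 3)),
      (c k • stPull (c k ^ 2) (c k) (τ k) (y k) X.u) s
          (EuclideanSpace.single 0 (-(‖X.u (τ k) (y k)‖ * y k 0)) +
            rotZ θ (z - EuclideanSpace.single 0 (-(‖X.u (τ k) (y k)‖ * y k 0)))) =
        rotZ θ ((c k • stPull (c k ^ 2) (c k) (τ k) (y k) X.u) s z) := by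
    intro k s hs θ z
    have h := X.zoom_halfPlane_rot_about hax (hc0 k) (hhalf k).1 hs θ z
    have hcinv : (c k)⁻¹ = ‖X.u (τ k) (y k)‖ := by rw [hc k, inv_inv]
    rwa [smul_single_zero_one, hcinv] at h
  have hinv : ∀ s < 0, ∀ (z : EuclideanSpace ℝ (Fin 3)) (δ : ℝ),
      W s (z + EuclideanSpace.single 1 δ) = W s z := by
    intro s hs z δ
    let Z : ℕ → EuclideanSpace ℝ (Fin 3) → EuclideanSpace ℝ (Fin 3) := fun j =>
      if τ (φ j) + c (φ j) ^ 2 * s ∈ Ico 0 X.T then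
        (c (φ j) • stPull (c (φ j) ^ 2) (c (φ j)) (τ (φ j)) (y (φ j)) X.u) s else 0
    have hZsym : ∀ j (θ : ℝ) (z : EuclideanSpace ℝ (Fin 3)),
        Z j (EuclideanSpace.single 0 (-(‖X.u (τ (φ j)) (y (φ j))‖ * y (φ j) 0)) +
            rotZ θ (z - EuclideanSpace.single 0 (-(‖X.u (τ (φ j)) (y (φ j))‖ * y (φ j) 0)))) =
          rotZ θ (Z j z) := by
      intro j θ z
      by_cases hv : τ (φ j) + c (φ j) ^ 2 * s ∈ Ico 0 X.T
      · simp only [Z, if_pos hv]; exact hsym (φ j) s hv θ z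
      · simp only [Z, if_neg hv, Pi.zero_apply, rotZ_apply_zero_vec]
    have hZconv : TendstoLocallyUniformly Z (W s) atTop := by
      refine tendstoLocallyUniformly_congr_eventually (hconv s hs) ?_
      filter_upwards [hmem s hs.le] with j hj
      simp only [Z, if_pos (show τ (φ j) + c (φ j) ^ 2 * s ∈ Ico 0 X.T from
        ⟨hj.1.le, hj.2.trans_lt (htI _).2⟩)]
    exact eq_of_tendstoLocallyUniformly_of_rot_about hMlim hZsym hZconv (hWsc s hs) z δ
  -- ### 2½-D Liouville and the Type-I decay
  have hconst := apply_eq_apply_zero_of_lineInvariant hbam hWc hinv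
  exact false_of_sliceConst_of_typeI_decay (C := C) (fun s hs => (hslice s hs).of_le (by norm_cast))
    ⟨8, hW8⟩ hWdiv hWmild hnt hIW hconst

/-! ## §2 No local Type-I bound at any singular point (`ν = 1`, then every `ν`) -/

/-- **NO LOCAL TYPE-I BOUND AT ANY SINGULAR POINT OF AN AXISYMMETRIC CLAY BLOW-UP, WITH THE FORCE**
(`ν = 1` core; axisymmetric slices; no named fact): at a point `x₁` which is not backward bounded (it
lies on the axis), for every `r₀ > 0` and `C` the bound `‖u(t, x)‖ ≤ C/√(T − t)` for `t` near `T`,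
`x ∈ B(x₁, r₀)` fails: §1 would make `|x'|‖u‖` locally bounded, which g11's local KNSS 6.1 with force
(`not_local_cylRadius_mul_norm_le_one`) excludes. [cite: KochNadirashviliSereginSverak2009, Thms 6.1–6.2]
[cite: SereginSverak2009, Thm 1.1] -/
theorem not_localTypeI_of_isAxisymmetric_one (Y : ClayBlowup 1)
    (hax : ∀ t ∈ Ico 0 Y.T, IsAxisymmetric (Y.u t)) {x₁ : EuclideanSpace ℝ (Fin 3)}
    (hx₁ax : cylRadius x₁ = 0) (hx₁ : ¬ IsBackwardBoundedAt Y.u Y.T x₁) {r₀ : ℝ} (hr₀ : 0 < r₀)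
    (C : ℝ) : ¬ ∀ᶠ t in 𝓝[<] Y.T, ∀ x ∈ ball x₁ r₀, ‖Y.u t x‖ ≤ C / Real.sqrt (Y.T - t) := by
  intro hCev
  have hT := Y.T_pos
  obtain ⟨t₁, ht₁T, hsub⟩ := mem_nhdsLT_iff_exists_Ioo_subset.1 hCev
  set t₀ : ℝ := max t₁ 0 with ht₀
  have ht₀I : t₀ ∈ Ico 0 Y.T := ⟨le_max_right _ _, max_lt ht₁T hT⟩
  set r₁ : ℝ := min r₀ 2 with hr₁
  have hr₁0 : 0 < r₁ := lt_min hr₀ two_pos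
  set C₁ : ℝ := max C 1 with hC₁
  have hC₁0 : 0 < C₁ := lt_of_lt_of_le one_pos (le_max_right _ _)
  have hI : ∀ t ∈ Ioo t₀ Y.T, ∀ x ∈ ball x₁ r₁, ‖Y.u t x‖ ≤ C₁ / Real.sqrt (Y.T - t) := by
    intro t ht x hx
    have ht' : t ∈ Ioo t₁ Y.T := ⟨lt_of_le_of_lt (le_max_left _ _) ht.1, ht.2⟩
    have h := hsub ht' x (ball_subset_ball (min_le_left _ _) hx)
    exact h.trans (div_le_div_of_nonneg_right (le_max_left _ _) (Real.sqrt_nonneg _))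
  obtain ⟨C', hC'⟩ := Y.exists_cylRadius_mul_norm_le_of_localTypeI_one hax hx₁ax hr₁0
    (min_le_right _ _) ht₀I hC₁0 hI
  exact Y.not_local_cylRadius_mul_norm_le_one hax hx₁ax hx₁ (by positivity : 0 < r₁ / 4)
    (show (t₀ + Y.T) / 2 < Y.T by linarith [ht₀I.2]) hC'

/-- **NO LOCAL TYPE-I BOUND AT ANY SINGULAR POINT OF AN AXISYMMETRIC CLAY BLOW-UP — WITH ITS CLAY FORCE,
UNCONDITIONALLY** (`ν > 0`; axisymmetric datum and axisymmetric Clay force; no named fact, no conjecture):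
at a point `x₁` which is not backward bounded at `T`, for every `r₀ > 0` and every `C`, the bound
`‖u(t, x)‖ ≤ C/√(T − t)` for `t` near `T` and `x ∈ B(x₁, r₀)` FAILS. (Viscosity normalisation by
`rescale`: `isBackwardBoundedAt_of_rescale`, `eventually_localTypeI_rescale`.)
[cite: KochNadirashviliSereginSverak2009, Thm 6.2] [cite: SereginSverak2009, Thm 1.1] -/
theorem not_localTypeI_of_isAxisymmetric_forced {ν : ℝ} (X : ClayBlowup ν) (hν : 0 < ν)
    (h0A : IsAxisymmetric (X.u 0)) (hfA : ∀ t ∈ Ico 0 X.T, IsAxisymmetric (X.f t))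
    {x₁ : EuclideanSpace ℝ (Fin 3)} (hx₁ : ¬ IsBackwardBoundedAt X.u X.T x₁) {r₀ : ℝ} (hr₀ : 0 < r₀)
    (C : ℝ) : ¬ ∀ᶠ t in 𝓝[<] X.T, ∀ x ∈ ball x₁ r₀, ‖X.u t x‖ ≤ C / Real.sqrt (X.T - t) := by
  intro hC
  have hax : ∀ t ∈ Ico 0 X.T, IsAxisymmetric (X.u t) := X.isAxisymmetric hν h0A hfA
  have hx₁ax : cylRadius x₁ = 0 := X.cylRadius_eq_zero_of_not_isBackwardBoundedAt hν h0A hfA hx₁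
  set a : ℝ := 1 / ν with ha
  have ha0 : 0 < a := by positivity
  have haxY : ∀ s ∈ Ico 0 (X.rescale hν one_pos).T, IsAxisymmetric ((X.rescale hν one_pos).u s) := by
    intro s hs
    rw [X.rescale_T hν one_pos] at hs
    have hmaps : a * s ∈ Ico 0 X.T := by
      refine ⟨mul_nonneg ha0.le hs.1, ?_⟩
      have := mul_lt_mul_of_pos_left hs.2 ha0
      rwa [mul_div_cancel₀ _ ha0.ne'] at this
    have e : (X.rescale hν one_pos).u s = fun z => a • X.u (a * s) z := by
      funext z; rw [X.rescale_u_apply hν one_pos]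
    rw [e]; exact (hax _ hmaps).const_smul a
  exact (X.rescale hν one_pos).not_localTypeI_of_isAxisymmetric_one haxY hx₁ax
    (fun h => hx₁ (X.isBackwardBoundedAt_of_rescale hν one_pos h)) hr₀ _
    (X.eventually_localTypeI_rescale hν one_pos hC)

/-- **Every singular point of an axisymmetric Clay blow-up is a point of LOCAL TYPE II GROWTH, with
the force** (`ν > 0`): for every `r₀ > 0`, `C` and `t₀ < T` there are `t ∈ (t₀, T)`, `x ∈ B(x₁, r₀)` with
`‖u(t, x)‖ > C/√(T − t)`. [cite: KochNadirashviliSereginSverak2009, Thm 6.2] -/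
theorem exists_gt_typeI_near_of_isAxisymmetric {ν : ℝ} (X : ClayBlowup ν) (hν : 0 < ν)
    (h0A : IsAxisymmetric (X.u 0)) (hfA : ∀ t ∈ Ico 0 X.T, IsAxisymmetric (X.f t))
    {x₁ : EuclideanSpace ℝ (Fin 3)} (hx₁ : ¬ IsBackwardBoundedAt X.u X.T x₁) {r₀ : ℝ} (hr₀ : 0 < r₀)
    (C : ℝ) {t₀ : ℝ} (ht₀ : t₀ < X.T) :
    ∃ t ∈ Ioo t₀ X.T, ∃ x ∈ ball x₁ r₀, C / Real.sqrt (X.T - t) < ‖X.u t x‖ := by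
  by_contra hcon
  push Not at hcon
  refine X.not_localTypeI_of_isAxisymmetric_forced hν h0A hfA hx₁ hr₀ C ?_
  filter_upwards [Ioo_mem_nhdsLT ht₀] with t ht x hx
  exact hcon t ht x hx

/-! ## §3 The global row: an axisymmetric Clay blow-up is Type II, unconditionally -/

/-- **AN AXISYMMETRIC CLAY BLOW-UP — WITH ITS CLAY FORCE — IS TYPE II, UNCONDITIONALLY** (`ν > 0`;
axisymmetric datum and Clay force; no named fact, NO conjecture): `¬ IsTypeIBlowup X.u X.T`. This
DISCHARGES the hypothesis `AxisymmetricLiouvilleBoundedSwirl` of g10's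
`not_typeI_of_isAxisymmetric_forced_of_liouville`: a global Type-I rate is in particular a local one at
the singular point of `exists_not_isBackwardBoundedAt`. [cite: KochNadirashviliSereginSverak2009, Thm 6.2]
[cite: SereginSverak2009, Thm 1.1] -/
theorem not_typeI_of_isAxisymmetric_clayForce {ν : ℝ} (X : ClayBlowup ν) (hν : 0 < ν)
    (h0A : IsAxisymmetric (X.u 0)) (hfA : ∀ t ∈ Ico 0 X.T, IsAxisymmetric (X.f t)) :
    ¬ IsTypeIBlowup X.u X.T := by
  rintro ⟨C, hC⟩
  obtain ⟨x₁, hx₁⟩ := X.exists_not_isBackwardBoundedAt hν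
  refine X.not_localTypeI_of_isAxisymmetric_forced hν h0A hfA hx₁ one_pos C ?_
  filter_upwards [hC] with t ht x _ using ht x

/-- **THE K8 ROW WITH THE CLAY FORCE, UNCONDITIONALLY** (`ν > 0`, axisymmetric datum and force): NEITHER
the Type-I rate `‖u(t,x)‖ ≤ C/√(T − t)` near `T` NOR the bound `r‖u(t,x)‖ ≤ C` on `[0, T) × ℝ³` holds
(second clause: g10's `not_cylRadius_mul_norm_le_of_isAxisymmetric`). Supersedes g10's conditional
`not_typeI_of_isAxisymmetric_forced`. [cite: KochNadirashviliSereginSverak2009, Thms 6.1–6.2] -/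
theorem k8_row_clayForce {ν : ℝ} (X : ClayBlowup ν) (hν : 0 < ν)
    (h0A : IsAxisymmetric (X.u 0)) (hfA : ∀ t ∈ Ico 0 X.T, IsAxisymmetric (X.f t)) :
    ¬ IsTypeIBlowup X.u X.T ∧
      ¬ ∃ C : ℝ, ∀ t ∈ Ico 0 X.T, ∀ x : EuclideanSpace ℝ (Fin 3), cylRadius x * ‖X.u t x‖ ≤ C :=
  ⟨X.not_typeI_of_isAxisymmetric_clayForce hν h0A hfA,
    X.not_cylRadius_mul_norm_le_of_isAxisymmetric hν h0A hfA⟩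

end ClayBlowup

/-! ## §4 Designed blow-ups and the (C)-reading -/

/-- **No local Type-I bound at any singular point of an axisymmetric designed blow-up, with its force.**
[cite: KochNadirashviliSereginSverak2009, Thm 6.2] -/
theorem DesignedBlowup.not_localTypeI_of_isAxisymmetric {ν : ℝ} (D : DesignedBlowup ν) (hν : 0 < ν)
    (h0A : IsAxisymmetric (D.u 0)) (hfA : ∀ t ∈ Ico 0 D.T, IsAxisymmetric (D.f t))
    {x₁ : EuclideanSpace ℝ (Fin 3)} (hx₁ : ¬ IsBackwardBoundedAt D.u D.T x₁) {r₀ : ℝ} (hr₀ : 0 < r₀)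
    (C : ℝ) : ¬ ∀ᶠ t in 𝓝[<] D.T, ∀ x ∈ ball x₁ r₀, ‖D.u t x‖ ≤ C / Real.sqrt (D.T - t) :=
  D.toClayBlowup.not_localTypeI_of_isAxisymmetric_forced hν h0A hfA hx₁ hr₀ C

/-- **An axisymmetric designed blow-up is Type II, unconditionally.**
[cite: KochNadirashviliSereginSverak2009, Thm 6.2] -/
theorem DesignedBlowup.not_typeI_of_isAxisymmetric_clayForce {ν : ℝ} (D : DesignedBlowup ν)
    (hν : 0 < ν) (h0A : IsAxisymmetric (D.u 0)) (hfA : ∀ t ∈ Ico 0 D.T, IsAxisymmetric (D.f t)) :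
    ¬ IsTypeIBlowup D.u D.T :=
  D.toClayBlowup.not_typeI_of_isAxisymmetric_clayForce hν h0A hfA

end Summit.NavierStokesRegularity.FluidComputer

end
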